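import Literature.Analysis.FluidPDE.CarlemanDensityC12
import Literature.Analysis.FluidPDE.BackwardUniquenessCoreSecond
import Literature.Analysis.FluidPDE.BackwardHeatSubsolution
import HarnessLib

/-!
# The Carleman inequalities with cut-offs in the class `C¹ ∩ {∂ₓu ∈ C¹}`
# (core of Seregin 2014, Lemmas A.1–A.3, verbatim)

Analysis/FluidPDE support file (theorems only; no definitions, no named facts) in the
backward-uniqueness / unique-continuation track used by the discharge of ESS Thm. 1.4
(`Literature.Analysis.FluidPDE.ess_local_holder`). The files `BackwardUniquenessCoreFirst`,
`BackwardUniquenessCoreSecond` prove the cut-off forms of the two Carleman inequalities for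
`v ∈ C²(O)`; their proofs use only `v ∈ C¹(O)` and `∂ₑv ∈ C¹(O)` (`e ∈ E`) — the Leibniz rule
for `Δ(ηv)` and the continuity of `∂ₛ(ηv) + Δ(ηv)`, `|∇(ηv)|²` — together with the density
theorem, which holds in that class (`CarlemanDensityC12`). This file records the same
statements in the class

  `C12(O)`: `v ∈ C¹(O)` and `∂ₑv = Dv(·)(0, e) ∈ C¹(O)` for every `e ∈ E`,

the regularity of the vorticity of a Navier–Stokes solution that is smooth in space (with
jointly continuous spatial derivatives) and `C¹` in time, which is what ESS §3 has in the far
field of the blow-up limit (the printed Thms. 4.1, 5.1 of ESS 2003 are stated for `W^{2,1}_2`).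

* closure of the class: `dt_add_lap_smul_apply_c12` (Leibniz), `contDiff_one_cutoff_smul_c12`,
  `contDiff_one_dx_cutoff_smul_c12` (cut-off products), continuity helpers;
* `norm_sq_dt_add_lap_smul_le_c12`, `carleman_first_smul_le_c12`, `core_first_c12` — the file
  `BackwardUniquenessCoreFirst` in the class (same constants, same proofs);
* `carleman_second_smul_le_c12` — `BackwardUniquenessCoreSecond` in the class.

## References

* G. Seregin, *Lecture notes on regularity theory for the Navier–Stokes equations*, World
  Scientific 2014, App. A.2, proof of Lemma A.1, (A.2.7)–(A.2.10); App. A.3, proofs of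
  Lemmas A.2–A.3, (A.3.11), p. 213. [Seregin2014]
* L. Escauriaza, G. Seregin, V. Šverák, Russ. Math. Surveys 58:2 (2003) 211–250, §§4–5.
-/

noncomputable section

open MeasureTheory Set Function Filter Metric
open _root_.Topology
open scoped InnerProductSpace RealInnerProductSpace

namespace Literature.Analysis.FluidPDE

namespace Carleman

/-! ### Closure properties of the class `C¹ ∩ {∂ₓu ∈ C¹}` -/

section C12Closure

variable {E : Type*} [NormedAddCommGroup E] [InnerProductSpace ℝ E] [FiniteDimensional ℝ E]
variable {F : Type*} [NormedAddCommGroup F] [NormedSpace ℝ F]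

omit [FiniteDimensional ℝ E] in
/-- First derivatives of a cut-off product on the open set where the factor is `C¹`:
`D(ηu)(z) d = η(z) Du(z) d + (Dη(z) d) u(z)`. [folklore] -/
theorem fderiv_cutoff_smul_apply_of_mem {η : ℝ × E → ℝ} {u : ℝ × E → F} {U : Set (ℝ × E)}
    (hU : IsOpen U) (hη : ContDiff ℝ 2 η) (hu : ContDiffOn ℝ 1 u U) {z : ℝ × E} (hz : z ∈ U)
    (d : ℝ × E) :
    fderiv ℝ (fun z => η z • u z) z d = η z • fderiv ℝ u z d + fderiv ℝ η z d • u z := by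
  have hηd : DifferentiableAt ℝ η z := (hη.differentiable (by norm_num)) z
  have hud : DifferentiableAt ℝ u z := (hu.differentiableOn one_ne_zero).differentiableAt (hU.mem_nhds hz)
  rw [fderiv_fun_smul hηd hud]
  simp

/-- **Leibniz rule in the class `C¹ ∩ {∂ₓu ∈ C¹}`**: at a point of an open set `U` where
`u ∈ C¹(U)` and every `∂ₑu ∈ C¹(U)`, for `η ∈ C²(ℝ × E)`,
`(∂ₜ + Δ)(ηu) = η (∂ₜ + Δ)u + ((∂ₜ + Δ)η) u + 2 Σᵢ ∂ᵢη ∂ᵢu`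
(the proof of `dt_add_lap_smul_apply`, which used exactly this regularity). [folklore] -/
theorem dt_add_lap_smul_apply_c12 {η : ℝ × E → ℝ} {u : ℝ × E → F} {U : Set (ℝ × E)}
    (hU : IsOpen U) (hη : ContDiff ℝ 2 η) (hu : ContDiffOn ℝ 1 u U)
    (hux : ∀ e : E, ContDiffOn ℝ 1 (dx e u) U) {z : ℝ × E} (hz : z ∈ U) :
    dt (fun z => η z • u z) z + lap (fun z => η z • u z) z =
      η z • (dt u z + lap u z) + (dt η z + lap η z) • u z +
        (2 : ℝ) • ∑ i, dx (stdOrthonormalBasis ℝ E i) η z • dx (stdOrthonormalBasis ℝ E i) u z := by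
  set b := stdOrthonormalBasis ℝ E with hb
  have hηd : ∀ z, DifferentiableAt ℝ η z := fun z => (hη.differentiable (by norm_num)) z
  have hud : ∀ z' ∈ U, DifferentiableAt ℝ u z' := fun z' hz' =>
    (hu.differentiableOn one_ne_zero).differentiableAt (hU.mem_nhds hz')
  -- first derivatives of the product on `U`
  have h1 : ∀ z' ∈ U, ∀ d, fderiv ℝ (fun z => η z • u z) z' d =
      η z' • fderiv ℝ u z' d + fderiv ℝ η z' d • u z' := fun z' hz' d =>
    fderiv_cutoff_smul_apply_of_mem hU hη hu hz' d
  -- differentiability of the frame derivatives at `z`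
  have hdxu : ∀ e : E, DifferentiableAt ℝ (dx e u) z := fun e =>
    ((hux e).differentiableOn one_ne_zero).differentiableAt (hU.mem_nhds hz)
  have hdxη : ∀ e : E, DifferentiableAt ℝ (dx e η) z := fun e => by
    have hc : ContDiff ℝ 1 fun z' => fderiv ℝ η z' (0, e) :=
      (hη.fderiv_right (m := 1) le_rfl).clm_apply contDiff_const
    exact (hc.differentiable one_ne_zero) z
  -- second frame derivatives of the product
  have h2 : ∀ e : E, dx e (dx e fun z => η z • u z) z =
      η z • dx e (dx e u) z + (2 : ℝ) • (dx e η z • dx e u z) + dx e (dx e η) z • u z := by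
    intro e
    have hev : dx e (fun z => η z • u z) =ᶠ[𝓝 z] fun z' => η z' • dx e u z' + dx e η z' • u z' := by
      filter_upwards [hU.mem_nhds hz] with z' hz'
      simp only [dx_apply]
      exact h1 z' hz' _
    rw [dx_apply, hev.fderiv_eq,
      fderiv_fun_add ((hηd z).fun_smul (hdxu e)) ((hdxη e).fun_smul (hud z hz)),
      fderiv_fun_smul (hηd z) (hdxu e), fderiv_fun_smul (hdxη e) (hud z hz)]
    simp only [add_apply, FunLike.coe_smul, Pi.smul_apply,
      ContinuousLinearMap.smulRight_apply, two_smul, dx_apply]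
    abel
  have hdt : dt (fun z => η z • u z) z = η z • dt u z + dt η z • u z := by
    simp only [dt_apply]
    exact h1 z hz _
  rw [hdt]
  simp only [lap]
  rw [Finset.sum_congr rfl fun i _ => h2 (b i), Finset.sum_add_distrib, Finset.sum_add_distrib,
    ← Finset.smul_sum, ← Finset.smul_sum, ← Finset.sum_smul, smul_add, add_smul]
  abel

omit [FiniteDimensional ℝ E] in
/-- **Cut-off products stay in the class, first half**: `η ∈ C²` with `tsupport η ⊆ U`, `U`
open, `u ∈ C¹(U)` ⇒ `ηu ∈ C¹(ℝ × E)`. [folklore] -/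
theorem contDiff_one_cutoff_smul_c12 {η : ℝ × E → ℝ} {u : ℝ × E → F} {U : Set (ℝ × E)}
    (hU : IsOpen U) (hη : ContDiff ℝ 2 η) (hηU : tsupport η ⊆ U) (hu : ContDiffOn ℝ 1 u U) :
    ContDiff ℝ 1 fun z => η z • u z :=
  contDiff_of_contDiffOn_of_eq_zero hU (isClosed_tsupport η) hηU
    ((hη.of_le (by norm_num)).contDiffOn.smul hu) fun z hz => by
      simp [image_eq_zero_of_notMem_tsupport hz]

omit [FiniteDimensional ℝ E] in
/-- **Cut-off products stay in the class, second half**: `η ∈ C²` with `tsupport η ⊆ U`, `U`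
open, `u ∈ C¹(U)`, `∂ₑu ∈ C¹(U)` ⇒ `∂ₑ(ηu) ∈ C¹(ℝ × E)`
(`∂ₑ(ηu) = η ∂ₑu + (∂ₑη) u` on `U`, `= 0` off `tsupport η`). [folklore] -/
theorem contDiff_one_dx_cutoff_smul_c12 {η : ℝ × E → ℝ} {u : ℝ × E → F} {U : Set (ℝ × E)}
    (hU : IsOpen U) (hη : ContDiff ℝ 2 η) (hηU : tsupport η ⊆ U) (hu : ContDiffOn ℝ 1 u U)
    (hux : ∀ e : E, ContDiffOn ℝ 1 (dx e u) U) (e : E) :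
    ContDiff ℝ 1 (dx e fun z => η z • u z) := by
  have hdxη : ContDiff ℝ 1 (dx e η) :=
    (hη.fderiv_right (m := 1) le_rfl).clm_apply contDiff_const
  have hon : ContDiffOn ℝ 1 (dx e fun z => η z • u z) U := by
    have h : ContDiffOn ℝ 1 (fun z => η z • dx e u z + dx e η z • u z) U :=
      (((hη.of_le (by norm_num)).contDiffOn.smul (hux e))).add (hdxη.contDiffOn.smul hu)
    refine h.congr fun z hz => ?_
    simp only [dx_apply]
    exact fderiv_cutoff_smul_apply_of_mem hU hη hu hz _
  refine contDiff_of_contDiffOn_of_eq_zero hU (isClosed_tsupport η) hηU hon fun z hz => ?_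
  have h0 : fderiv ℝ (fun z => η z • u z) z = 0 :=
    fderiv_of_notMem_tsupport (𝕜 := ℝ) fun h => hz (tsupport_smul_subset_left η u h)
  simp [dx_apply, h0]

/-- In the class, `∂ₛw + Δw` is continuous (`w ∈ C¹`, `∂ₑw ∈ C¹` globally). [folklore] -/
theorem continuous_dt_add_lap_c12 {w : ℝ × E → F} (hw : ContDiff ℝ 1 w)
    (hwx : ∀ e : E, ContDiff ℝ 1 (dx e w)) : Continuous fun z => dt w z + lap w z := by
  have cdt : Continuous (dt w) := (hw.continuous_fderiv one_ne_zero).clm_apply continuous_const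
  have clap : Continuous (lap w) := by
    unfold lap
    refine continuous_finsetSum _ fun i _ => ?_
    exact ((hwx _).continuous_fderiv one_ne_zero).clm_apply continuous_const
  exact cdt.add clap

omit [FiniteDimensional ℝ E] in
/-- `z ↦ Dw(z) d` is continuous for `w ∈ C¹`. [folklore] -/
theorem continuous_fderiv_apply_c1 {w : ℝ × E → F} (hw : ContDiff ℝ 1 w) (d : ℝ × E) :
    Continuous fun z => fderiv ℝ w z d :=
  (hw.continuous_fderiv one_ne_zero).clm_apply continuous_const

/-- `|∇v|²` is continuous on an open `O` for `v ∈ C¹(O)`. [folklore] -/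
theorem continuousOn_gradSq_c1 {v : ℝ × E → F} {O : Set (ℝ × E)} (hO : IsOpen O)
    (hv : ContDiffOn ℝ 1 v O) : ContinuousOn (gradSq v) O := by
  have hf : ContinuousOn (fderiv ℝ v) O := hv.continuousOn_fderiv_of_isOpen hO le_rfl
  show ContinuousOn (fun z => gradSq v z) O
  simp only [gradSq, dx]
  exact continuousOn_finsetSum _ fun i _ => ((hf.clm_apply continuousOn_const).norm.pow 2)

end C12Closure

/-! ### The first Carleman inequality with cut-offs, in the class -/

section CoreFirstC12

variable {E : Type*} [NormedAddCommGroup E] [InnerProductSpace ℝ E] [FiniteDimensional ℝ E]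
  [MeasurableSpace E] [BorelSpace E]
variable {F : Type*} [NormedAddCommGroup F] [InnerProductSpace ℝ F] [CompleteSpace F]

omit [MeasurableSpace E] [BorelSpace E] [CompleteSpace F] in
/-- **Pointwise bound for the cut-off product** (Seregin 2014, (A.2.7), (A.3.11), squared): at a
point `z` of an open set `O` where `v ∈ C²(O)` satisfies `|∂ₛv + Δv| ≤ c(|v| + |∇v|)`, for
`η ∈ C²` with `η(z) ≥ 0`, `v` in the class `C¹ ∩ {∂ₓv ∈ C¹}` near `z`, and `w = ηv`,
`|∂ₛw + Δw|² ≤ 6c²(|w|² + 2|∇w|² + 2|∇η|²|v|²) + 3(∂ₛη + Δη)²|v|² + 12|∇η|²|∇v|²`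
(Leibniz rule, `(X+Y+Z)² ≤ 3(X²+Y²+Z²)`, `(|v| + |∇v|)² ≤ 2(|v|² + |∇v|²)` and
`η²|∇v|² ≤ 2|∇w|² + 2|∇η|²|v|²`). [cite: Seregin2014, App. A.3, proof of Lemma A.2, (A.3.11)] -/
theorem norm_sq_dt_add_lap_smul_le_c12 {η : ℝ × E → ℝ} {v : ℝ × E → F} {O : Set (ℝ × E)} {c : ℝ}
    {z : ℝ × E} (hO : IsOpen O) (hη : ContDiff ℝ 2 η) (hv : ContDiffOn ℝ 1 v O)
    (hvx : ∀ e : E, ContDiffOn ℝ 1 (dx e v) O) (hz : z ∈ O)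
    (hη0 : 0 ≤ η z) (hBH : ‖dt v z + lap v z‖ ≤ c * (‖v z‖ + Real.sqrt (gradSq v z))) :
    ‖dt (fun y => η y • v y) z + lap (fun y => η y • v y) z‖ ^ 2 ≤
      6 * c ^ 2 * (‖η z • v z‖ ^ 2 + 2 * gradSq (fun y => η y • v y) z +
        2 * gradSq η z * ‖v z‖ ^ 2) +
      3 * (dt η z + lap η z) ^ 2 * ‖v z‖ ^ 2 + 12 * gradSq η z * gradSq v z := by
  have hηd : DifferentiableAt ℝ η z := (hη.differentiable (by norm_num)) z
  have hvd : DifferentiableAt ℝ v z :=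
    (hv.differentiableOn one_ne_zero).differentiableAt (hO.mem_nhds hz)
  -- Leibniz
  rw [dt_add_lap_smul_apply_c12 hO hη hv hvx hz]
  -- the three pieces
  set X : ℝ := η z * ‖dt v z + lap v z‖ with hX
  set Y : ℝ := |dt η z + lap η z| * ‖v z‖ with hY
  set Z : ℝ := 2 * (Real.sqrt (gradSq η z) * Real.sqrt (gradSq v z)) with hZ
  have hX0 : 0 ≤ X := mul_nonneg hη0 (norm_nonneg _)
  have hnorm : ‖η z • (dt v z + lap v z) + (dt η z + lap η z) • v z +
      (2 : ℝ) • ∑ i, dx (stdOrthonormalBasis ℝ E i) η z • dx (stdOrthonormalBasis ℝ E i) v z‖ ≤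
      X + Y + Z := by
    refine (norm_add_le _ _).trans (add_le_add ((norm_add_le _ _).trans (add_le_add ?_ ?_)) ?_)
    · rw [norm_smul, Real.norm_eq_abs, abs_of_nonneg hη0]
    · rw [norm_smul, Real.norm_eq_abs]
    · rw [norm_smul, Real.norm_eq_abs, abs_two]
      exact mul_le_mul_of_nonneg_left (norm_sum_dx_smul_dx_le η v z) zero_le_two
  have hsq : ‖η z • (dt v z + lap v z) + (dt η z + lap η z) • v z +
      (2 : ℝ) • ∑ i, dx (stdOrthonormalBasis ℝ E i) η z • dx (stdOrthonormalBasis ℝ E i) v z‖ ^ 2 ≤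
      3 * (X ^ 2 + Y ^ 2 + Z ^ 2) :=
    (pow_le_pow_left₀ (norm_nonneg _) hnorm 2).trans (by
      nlinarith [sq_nonneg (X - Y), sq_nonneg (Y - Z), sq_nonneg (X - Z)])
  -- `X² ≤ 2c²(‖w‖² + 2|∇w|² + 2|∇η|²‖v‖²)`
  have hXb : X ^ 2 ≤ 2 * c ^ 2 * (‖η z • v z‖ ^ 2 + 2 * gradSq (fun y => η y • v y) z +
      2 * gradSq η z * ‖v z‖ ^ 2) := by
    have h2 : X ^ 2 ≤ (η z * (c * (‖v z‖ + Real.sqrt (gradSq v z)))) ^ 2 :=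
      pow_le_pow_left₀ hX0 (mul_le_mul_of_nonneg_left hBH hη0) 2
    have h3 : (‖v z‖ + Real.sqrt (gradSq v z)) ^ 2 ≤ 2 * (‖v z‖ ^ 2 + gradSq v z) := by
      have := Real.sq_sqrt (gradSq_nonneg v z)
      nlinarith [sq_nonneg (‖v z‖ - Real.sqrt (gradSq v z))]
    have h4 : η z ^ 2 * gradSq v z ≤
        2 * gradSq (fun y => η y • v y) z + 2 * gradSq η z * ‖v z‖ ^ 2 := sq_mul_gradSq_le hηd hvd
    have h5 : ‖η z • v z‖ ^ 2 = η z ^ 2 * ‖v z‖ ^ 2 := by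
      rw [norm_smul, Real.norm_eq_abs, mul_pow, sq_abs]
    calc X ^ 2 ≤ (η z * (c * (‖v z‖ + Real.sqrt (gradSq v z)))) ^ 2 := h2
      _ = c ^ 2 * (η z ^ 2 * (‖v z‖ + Real.sqrt (gradSq v z)) ^ 2) := by ring
      _ ≤ c ^ 2 * (η z ^ 2 * (2 * (‖v z‖ ^ 2 + gradSq v z))) := by gcongr
      _ = 2 * c ^ 2 * (η z ^ 2 * ‖v z‖ ^ 2 + η z ^ 2 * gradSq v z) := by ring
      _ ≤ 2 * c ^ 2 * (η z ^ 2 * ‖v z‖ ^ 2 +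
          (2 * gradSq (fun y => η y • v y) z + 2 * gradSq η z * ‖v z‖ ^ 2)) := by gcongr
      _ = 2 * c ^ 2 * (‖η z • v z‖ ^ 2 + 2 * gradSq (fun y => η y • v y) z +
          2 * gradSq η z * ‖v z‖ ^ 2) := by rw [h5]; ring
  -- `Y² = (∂ₛη + Δη)² ‖v‖²`, `Z² = 4 |∇η|² |∇v|²`
  have hYb : Y ^ 2 = (dt η z + lap η z) ^ 2 * ‖v z‖ ^ 2 := by rw [hY, mul_pow, sq_abs]
  have hZb : Z ^ 2 = 4 * (gradSq η z * gradSq v z) := by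
    rw [hZ, mul_pow, mul_pow, Real.sq_sqrt (gradSq_nonneg η z), Real.sq_sqrt (gradSq_nonneg v z)]
    ring
  calc _ ≤ 3 * (X ^ 2 + Y ^ 2 + Z ^ 2) := hsq
    _ ≤ 3 * (2 * c ^ 2 * (‖η z • v z‖ ^ 2 + 2 * gradSq (fun y => η y • v y) z +
          2 * gradSq η z * ‖v z‖ ^ 2) + (dt η z + lap η z) ^ 2 * ‖v z‖ ^ 2 +
          4 * (gradSq η z * gradSq v z)) := by rw [← hYb, ← hZb]; gcongr
    _ = _ := by ring


/-- **The first Carleman inequality for `w = ηv`, with the lower-order terms absorbed**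
(Seregin 2014, (A.2.8)–(A.2.10), (A.3.11)): let `0 < s₁`, `a ≥ 2`, `η ∈ C²` with
`tsupport η ⊆ [s₁, 7/4] × B̄(0, R)`, `η ≥ 0`, and `v ∈ C¹(O)`, `∂ₑv ∈ C¹(O)` (`e ∈ E`), on an open
`O ⊇ [s₁, 7/4] × B̄(0, R)` with `|∂ₛv + Δv| ≤ c(|v| + |∇v|)` on `O`, `c² ≤ 1/(24 c₀)`,
`c₀ = 11e^{4/3}` the constant of `carleman_inequality_first`. Then, with `W = h^{-2a}(s)e^{-|y|²/4s}`,
for every measurable `G` on which `η = 1`,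
`∫_G W|v|² ≤ ∫ W|ηv|² ≤ ∫ W|∇η|²|v|² + 6c₀ ∫ W(∂ₛη + Δη)²|v|² + 24c₀ ∫ W|∇η|²|∇v|²`
(all integrands on the right vanish off `tsupport η`). [cite: Seregin2014, App. A.3, proof of Lemma A.2, (A.3.11)] -/
theorem carleman_first_smul_le_c12 {η : ℝ × E → ℝ} {v : ℝ × E → F} {O : Set (ℝ × E)}
    {c a s₁ R : ℝ} (hO : IsOpen O) (hs₁ : 0 < s₁)
    (hKO : Icc s₁ (7 / 4) ×ˢ closedBall (0 : E) R ⊆ O) (hv : ContDiffOn ℝ 1 v O)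
    (hvx : ∀ e : E, ContDiffOn ℝ 1 (dx e v) O)
    (hBH : ∀ z ∈ O, ‖dt v z + lap v z‖ ≤ c * (‖v z‖ + Real.sqrt (gradSq v z)))
    (hcκ : c ^ 2 ≤ 1 / (24 * (11 * Real.exp (4 / 3)))) (ha : 2 ≤ a)
    (hη : ContDiff ℝ 2 η) (hηc : HasCompactSupport η)
    (hηK : tsupport η ⊆ Icc s₁ (7 / 4) ×ˢ closedBall (0 : E) R) (hη0 : ∀ z, 0 ≤ η z)
    {G : Set (ℝ × E)} (hGm : MeasurableSet G) (hG1 : ∀ z ∈ G, η z = 1) :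
    ∫ z in G, carlemanWeight a z * ‖v z‖ ^ 2 ≤
      (∫ z, carlemanWeight a z * (gradSq η z * ‖v z‖ ^ 2)) +
      6 * (11 * Real.exp (4 / 3)) *
        (∫ z, carlemanWeight a z * ((dt η z + lap η z) ^ 2 * ‖v z‖ ^ 2)) +
      24 * (11 * Real.exp (4 / 3)) * ∫ z, carlemanWeight a z * (gradSq η z * gradSq v z) := by
  set c₀ : ℝ := 11 * Real.exp (4 / 3) with hc₀
  have hc₀0 : 0 < c₀ := by positivity
  -- ### geometry
  set K : Set (ℝ × E) := Icc s₁ (7 / 4) ×ˢ closedBall (0 : E) R with hK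
  have hKc : IsCompact K := isCompact_Icc.prod (isCompact_closedBall _ _)
  set Ω : Set (ℝ × E) := {z | s₁ / 2 < z.1} with hΩ
  have hΩo : IsOpen Ω := isOpen_lt continuous_const continuous_fst
  have hKΩ : K ⊆ Ω := fun z hz => by
    show s₁ / 2 < z.1
    linarith [hz.1.1]
  have hTc : IsCompact (tsupport η) := hηc
  have hTΩ : tsupport η ⊆ Ω := hηK.trans hKΩ
  have hTO : tsupport η ⊆ O := hηK.trans hKO
  set W : ℝ × E → ℝ := carlemanWeight a with hWdef
  have hWc : ContinuousOn W Ω := continuousOn_carlemanWeight a hs₁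
  have hW0 : ∀ z ∈ Ω, 0 ≤ W z := fun z hz => (carlemanWeight_pos a (lt_trans (by positivity) hz)).le
  -- ### `w = η v`
  set w : ℝ × E → F := fun z => η z • v z with hw
  have hw0 : ∀ z ∉ tsupport η, w z = 0 := fun z hz => by
    simp [hw, image_eq_zero_of_notMem_tsupport hz]
  have hwK : tsupport w ⊆ tsupport η := by
    refine closure_minimal (fun z hz => ?_) (isClosed_tsupport η)
    by_contra h
    exact hz (hw0 z h)
  have hw1 : ContDiff ℝ 1 w := contDiff_one_cutoff_smul_c12 hO hη hTO hv
  have hwx : ∀ e' : E, ContDiff ℝ 1 (dx e' w) := fun e' =>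
    contDiff_one_dx_cutoff_smul_c12 hO hη hTO hv hvx e'
  have hwc : HasCompactSupport w := hηc.mono' ((subset_tsupport _).trans hwK)
  have hws : tsupport w ⊆ Ioo (0 : ℝ) 2 ×ˢ (univ : Set E) := by
    intro z hz
    have hzK := hηK (hwK hz)
    exact ⟨⟨lt_of_lt_of_le hs₁ hzK.1.1, lt_of_le_of_lt hzK.1.2 (by norm_num)⟩, mem_univ _⟩
  -- ### vanishing off `tsupport η`
  have hηd0 : ∀ z ∉ tsupport η, fderiv ℝ η z = 0 := fun z hz =>
    fderiv_of_notMem_tsupport (𝕜 := ℝ) hz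
  have hgη0 : ∀ z ∉ tsupport η, gradSq η z = 0 := fun z hz => by simp [gradSq, dx, hηd0 z hz]
  have hlapη0 : ∀ z ∉ tsupport η, lap η z = 0 := fun z hz =>
    image_eq_zero_of_notMem_tsupport fun h => hz (tsupport_lap_subset η h)
  have hdtη0 : ∀ z ∉ tsupport η, dt η z = 0 := fun z hz => by simp [dt, hηd0 z hz]
  have hwd0 : ∀ z ∉ tsupport η, fderiv ℝ w z = 0 := fun z hz =>
    fderiv_of_notMem_tsupport (𝕜 := ℝ) fun h => hz (hwK h)
  have hgw0 : ∀ z ∉ tsupport η, gradSq w z = 0 := fun z hz => by simp [gradSq, dx, hwd0 z hz]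
  have hlapw0 : ∀ z ∉ tsupport η, lap w z = 0 := fun z hz =>
    image_eq_zero_of_notMem_tsupport fun h => hz (hwK (tsupport_lap_subset w h))
  have hdtw0 : ∀ z ∉ tsupport η, dt w z = 0 := fun z hz => by simp [dt, hwd0 z hz]
  have hPw0 : ∀ z ∉ tsupport η, dt w z + lap w z = 0 := fun z hz => by
    rw [hdtw0 z hz, hlapw0 z hz, add_zero]
  -- ### continuity
  have cw : Continuous w := hw1.continuous
  have cfdr : ∀ {f : ℝ × E → ℝ}, ContDiff ℝ 2 f → ∀ u : ℝ × E, Continuous fun z => fderiv ℝ f z u :=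
    fun hf u => (hf.continuous_fderiv (by norm_num)).clm_apply continuous_const
  have cfd2r : ∀ {f : ℝ × E → ℝ}, ContDiff ℝ 2 f → ∀ u u' : ℝ × E,
      Continuous fun z => fderiv ℝ (fun y => fderiv ℝ f y u) z u' := by
    intro f hf u u'
    have h1 : ContDiff ℝ 1 fun y => fderiv ℝ f y u :=
      (hf.fderiv_right (m := 1) le_rfl).clm_apply contDiff_const
    exact (h1.continuous_fderiv one_ne_zero).clm_apply continuous_const
  have cPw : Continuous fun z => dt w z + lap w z := continuous_dt_add_lap_c12 hw1 hwx
  have cgw : Continuous (gradSq w) := continuous_gradSq_of_one hw1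
  have cPη : Continuous fun z => dt η z + lap η z := by
    simp only [dt, lap, dx]
    exact (cfdr hη _).add (continuous_finsetSum _ fun i _ => cfd2r hη _ _)
  have cgη : Continuous (gradSq η) := by
    show Continuous fun z => gradSq η z
    simp only [gradSq, dx]
    exact continuous_finsetSum _ fun i _ => ((cfdr hη _).norm.pow 2)
  have cvO : ContinuousOn v O := hv.continuousOn
  have cgvO : ContinuousOn (gradSq v) O := by
    have hf : ContinuousOn (fderiv ℝ v) O := hv.continuousOn_fderiv_of_isOpen hO le_rfl
    show ContinuousOn (fun z => gradSq v z) O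
    simp only [gradSq, dx]
    exact continuousOn_finsetSum _ fun i _ => ((hf.clm_apply continuousOn_const).norm.pow 2)
  -- ### integrability of all the weighted integrands
  have iw : Integrable fun z => W z * ‖w z‖ ^ 2 :=
    integrable_weight_mul hΩo hTc hTΩ hWc (cw.norm.pow 2) fun z hz => by simp [hw0 z hz]
  have igw : Integrable fun z => W z * gradSq w z :=
    integrable_weight_mul hΩo hTc hTΩ hWc cgw hgw0
  have iPw : Integrable fun z => W z * ‖dt w z + lap w z‖ ^ 2 :=
    integrable_weight_mul hΩo hTc hTΩ hWc (cPw.norm.pow 2) fun z hz => by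
      rw [hPw0 z hz]; simp
  have hWs : ContinuousOn (fun z : ℝ × E => W z * (a / z.1)) Ω :=
    hWc.mul (continuousOn_const.div continuous_fst.continuousOn fun z hz =>
      (lt_trans (by positivity) hz : (0 : ℝ) < z.1).ne')
  have iws : Integrable fun z => W z * (a / z.1) * ‖w z‖ ^ 2 :=
    integrable_weight_mul hΩo hTc hTΩ hWs (cw.norm.pow 2) fun z hz => by simp [hw0 z hz]
  have iJ1 : Integrable fun z => W z * (gradSq η z * ‖v z‖ ^ 2) :=
    integrable_weight_mul hΩo hTc hTΩ hWc
      (continuous_mul_of_eq_zero_off hO (isClosed_tsupport η) hTO cgη hgη0 (cvO.norm.pow 2))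
      fun z hz => by simp [hgη0 z hz]
  have iJ2 : Integrable fun z => W z * ((dt η z + lap η z) ^ 2 * ‖v z‖ ^ 2) :=
    integrable_weight_mul hΩo hTc hTΩ hWc
      (continuous_mul_of_eq_zero_off hO (isClosed_tsupport η) hTO (cPη.pow 2)
        (fun z hz => by rw [hdtη0 z hz, hlapη0 z hz]; simp) (cvO.norm.pow 2))
      fun z hz => by rw [hdtη0 z hz, hlapη0 z hz]; simp
  have iJ3 : Integrable fun z => W z * (gradSq η z * gradSq v z) :=
    integrable_weight_mul hΩo hTc hTΩ hWc
      (continuous_mul_of_eq_zero_off hO (isClosed_tsupport η) hTO cgη hgη0 cgvO)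
      fun z hz => by simp [hgη0 z hz]
  -- ### the Carleman inequality and the lower bound of its left-hand side
  have hCarl := carleman_inequality_first_of_c12 (E := E) (F := F)
    (by linarith : (0 : ℝ) < a) hw1 hwx hwc hws
  have hLHS : (∫ z, W z * ‖w z‖ ^ 2) + (∫ z, W z * gradSq w z) ≤
      ∫ z, W z * (a / z.1 * ‖w z‖ ^ 2 + gradSq w z) := by
    have e0 : (∫ z, W z * ‖w z‖ ^ 2) + (∫ z, W z * gradSq w z) =
        ∫ z, (W z * ‖w z‖ ^ 2 + W z * gradSq w z) := (integral_add iw igw).symm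
    rw [e0]
    have e : (fun z => W z * (a / z.1 * ‖w z‖ ^ 2 + gradSq w z)) =
        fun z => W z * (a / z.1) * ‖w z‖ ^ 2 + W z * gradSq w z := by funext z; ring
    rw [e]
    refine integral_mono (iw.add igw) (iws.add igw) fun z => ?_
    by_cases hz : z ∈ tsupport η
    · have hzK := hηK hz
      have hWz : 0 ≤ W z := hW0 z (hKΩ hzK)
      have hs : 1 ≤ a / z.1 := by
        rw [le_div_iff₀ (lt_of_lt_of_le hs₁ hzK.1.1)]
        linarith [hzK.1.2]
      have h1 : W z * ‖w z‖ ^ 2 ≤ W z * (a / z.1) * ‖w z‖ ^ 2 := by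
        have := mul_le_mul_of_nonneg_left hs (mul_nonneg hWz (sq_nonneg ‖w z‖))
        linarith [this]
      exact add_le_add h1 le_rfl
    · simp [hw0 z hz]
  -- ### the pointwise bound and its integral
  have hP : ∀ z, W z * ‖dt w z + lap w z‖ ^ 2 ≤
      6 * c ^ 2 * (W z * ‖w z‖ ^ 2 + 2 * (W z * gradSq w z) +
        2 * (W z * (gradSq η z * ‖v z‖ ^ 2))) +
      3 * (W z * ((dt η z + lap η z) ^ 2 * ‖v z‖ ^ 2)) +
      12 * (W z * (gradSq η z * gradSq v z)) := by
    intro z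
    by_cases hz : z ∈ tsupport η
    · have hWz : 0 ≤ W z := hW0 z (hTΩ hz)
      have h := mul_le_mul_of_nonneg_left
        (norm_sq_dt_add_lap_smul_le_c12 hO hη hv hvx (hTO hz) (hη0 z) (hBH z (hTO hz))) hWz
      refine h.trans (le_of_eq ?_)
      simp only [hw]
      ring
    · rw [hPw0 z hz, hw0 z hz, hgw0 z hz, hgη0 z hz, hdtη0 z hz, hlapη0 z hz]
      simp
  have hRHS : ∫ z, W z * ‖dt w z + lap w z‖ ^ 2 ≤
      6 * c ^ 2 * ((∫ z, W z * ‖w z‖ ^ 2) + 2 * (∫ z, W z * gradSq w z) +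
        2 * ∫ z, W z * (gradSq η z * ‖v z‖ ^ 2)) +
      3 * (∫ z, W z * ((dt η z + lap η z) ^ 2 * ‖v z‖ ^ 2)) +
      12 * ∫ z, W z * (gradSq η z * gradSq v z) := by
    have iA0 : Integrable fun z => W z * ‖w z‖ ^ 2 + 2 * (W z * gradSq w z) +
        2 * (W z * (gradSq η z * ‖v z‖ ^ 2)) := (iw.add (igw.const_mul 2)).add (iJ1.const_mul 2)
    have iA : Integrable fun z => 6 * c ^ 2 * (W z * ‖w z‖ ^ 2 + 2 * (W z * gradSq w z) +
        2 * (W z * (gradSq η z * ‖v z‖ ^ 2))) := iA0.const_mul _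
    have iB : Integrable fun z => 3 * (W z * ((dt η z + lap η z) ^ 2 * ‖v z‖ ^ 2)) :=
      iJ2.const_mul 3
    have iC : Integrable fun z => 12 * (W z * (gradSq η z * gradSq v z)) := iJ3.const_mul 12
    have hmono : ∫ z, W z * ‖dt w z + lap w z‖ ^ 2 ≤
        ∫ z, (6 * c ^ 2 * (W z * ‖w z‖ ^ 2 + 2 * (W z * gradSq w z) +
          2 * (W z * (gradSq η z * ‖v z‖ ^ 2))) +
          3 * (W z * ((dt η z + lap η z) ^ 2 * ‖v z‖ ^ 2)) +
          12 * (W z * (gradSq η z * gradSq v z))) := integral_mono iPw ((iA.add iB).add iC) hP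
    have e1a : ∫ z, (6 * c ^ 2 * (W z * ‖w z‖ ^ 2 + 2 * (W z * gradSq w z) +
        2 * (W z * (gradSq η z * ‖v z‖ ^ 2))) +
        3 * (W z * ((dt η z + lap η z) ^ 2 * ‖v z‖ ^ 2)) +
        12 * (W z * (gradSq η z * gradSq v z))) =
        (∫ z, (6 * c ^ 2 * (W z * ‖w z‖ ^ 2 + 2 * (W z * gradSq w z) +
          2 * (W z * (gradSq η z * ‖v z‖ ^ 2))) +
          3 * (W z * ((dt η z + lap η z) ^ 2 * ‖v z‖ ^ 2)))) +
        ∫ z, 12 * (W z * (gradSq η z * gradSq v z)) := integral_add (iA.add iB) iC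
    have e1b : ∫ z, (6 * c ^ 2 * (W z * ‖w z‖ ^ 2 + 2 * (W z * gradSq w z) +
          2 * (W z * (gradSq η z * ‖v z‖ ^ 2))) +
          3 * (W z * ((dt η z + lap η z) ^ 2 * ‖v z‖ ^ 2))) =
        (∫ z, 6 * c ^ 2 * (W z * ‖w z‖ ^ 2 + 2 * (W z * gradSq w z) +
          2 * (W z * (gradSq η z * ‖v z‖ ^ 2)))) +
        ∫ z, 3 * (W z * ((dt η z + lap η z) ^ 2 * ‖v z‖ ^ 2)) := integral_add iA iB
    have e2a : ∫ z, 6 * c ^ 2 * (W z * ‖w z‖ ^ 2 + 2 * (W z * gradSq w z) +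
        2 * (W z * (gradSq η z * ‖v z‖ ^ 2))) =
        6 * c ^ 2 * ∫ z, (W z * ‖w z‖ ^ 2 + 2 * (W z * gradSq w z) +
          2 * (W z * (gradSq η z * ‖v z‖ ^ 2))) := integral_const_mul _ _
    have e2b : ∫ z, (W z * ‖w z‖ ^ 2 + 2 * (W z * gradSq w z) +
        2 * (W z * (gradSq η z * ‖v z‖ ^ 2))) =
        (∫ z, (W z * ‖w z‖ ^ 2 + 2 * (W z * gradSq w z))) +
          ∫ z, 2 * (W z * (gradSq η z * ‖v z‖ ^ 2)) :=
      integral_add (iw.add (igw.const_mul 2)) (iJ1.const_mul 2)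
    have e2c : ∫ z, (W z * ‖w z‖ ^ 2 + 2 * (W z * gradSq w z)) =
        (∫ z, W z * ‖w z‖ ^ 2) + ∫ z, 2 * (W z * gradSq w z) := integral_add iw (igw.const_mul 2)
    have e2d : ∫ z, 2 * (W z * gradSq w z) = 2 * ∫ z, W z * gradSq w z := integral_const_mul _ _
    have e2e : ∫ z, 2 * (W z * (gradSq η z * ‖v z‖ ^ 2)) =
        2 * ∫ z, W z * (gradSq η z * ‖v z‖ ^ 2) := integral_const_mul _ _
    have e3 : ∫ z, 3 * (W z * ((dt η z + lap η z) ^ 2 * ‖v z‖ ^ 2)) =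
        3 * ∫ z, W z * ((dt η z + lap η z) ^ 2 * ‖v z‖ ^ 2) := integral_const_mul _ _
    have e4 : ∫ z, 12 * (W z * (gradSq η z * gradSq v z)) =
        12 * ∫ z, W z * (gradSq η z * gradSq v z) := integral_const_mul _ _
    rw [e1a, e1b, e2a, e2b, e2c, e2d, e2e, e3, e4] at hmono
    exact hmono
  -- ### absorption
  have hI0w : 0 ≤ ∫ z, W z * ‖w z‖ ^ 2 := integral_nonneg fun z => by
    by_cases hz : z ∈ tsupport η
    · exact mul_nonneg (hW0 z (hTΩ hz)) (sq_nonneg _)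
    · simp [hw0 z hz]
  have hI0g : 0 ≤ ∫ z, W z * gradSq w z := integral_nonneg fun z => by
    by_cases hz : z ∈ tsupport η
    · exact mul_nonneg (hW0 z (hTΩ hz)) (gradSq_nonneg w z)
    · simp [hgw0 z hz]
  have hJ10 : 0 ≤ ∫ z, W z * (gradSq η z * ‖v z‖ ^ 2) := integral_nonneg fun z => by
    by_cases hz : z ∈ tsupport η
    · exact mul_nonneg (hW0 z (hTΩ hz)) (mul_nonneg (gradSq_nonneg η z) (sq_nonneg _))
    · simp [hgη0 z hz]
  have hJ20 : 0 ≤ ∫ z, W z * ((dt η z + lap η z) ^ 2 * ‖v z‖ ^ 2) := integral_nonneg fun z => by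
    by_cases hz : z ∈ tsupport η
    · exact mul_nonneg (hW0 z (hTΩ hz)) (mul_nonneg (sq_nonneg _) (sq_nonneg _))
    · rw [hdtη0 z hz, hlapη0 z hz]; simp
  have hJ30 : 0 ≤ ∫ z, W z * (gradSq η z * gradSq v z) := integral_nonneg fun z => by
    by_cases hz : z ∈ tsupport η
    · exact mul_nonneg (hW0 z (hTΩ hz)) (mul_nonneg (gradSq_nonneg η z) (gradSq_nonneg v z))
    · simp [hgη0 z hz]
  have hcc : 6 * c₀ * c ^ 2 ≤ 1 / 4 := by
    have h := mul_le_mul_of_nonneg_left hcκ (by positivity : (0 : ℝ) ≤ 6 * c₀)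
    rw [show 6 * c₀ * (1 / (24 * (11 * Real.exp (4 / 3)))) = 1 / 4 by
      rw [hc₀]; field_simp; ring] at h
    exact h
  have hchain := (hLHS.trans hCarl).trans (mul_le_mul_of_nonneg_left hRHS hc₀0.le)
  -- linear arithmetic in the six integrals
  set Iw := ∫ z, W z * ‖w z‖ ^ 2 with hIw
  set Ig := ∫ z, W z * gradSq w z with hIg
  set J1 := ∫ z, W z * (gradSq η z * ‖v z‖ ^ 2) with hJ1
  set J2 := ∫ z, W z * ((dt η z + lap η z) ^ 2 * ‖v z‖ ^ 2) with hJ2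
  set J3 := ∫ z, W z * (gradSq η z * gradSq v z) with hJ3
  have hIP0 : 0 ≤ Iw + 2 * Ig + 2 * J1 := by linarith
  have h6 : c₀ * (6 * c ^ 2 * (Iw + 2 * Ig + 2 * J1)) ≤ (1 / 4) * (Iw + 2 * Ig + 2 * J1) := by
    have := mul_le_mul_of_nonneg_right hcc hIP0
    linarith [this]
  -- ### the left-hand side on `G`
  have hG : ∫ z in G, W z * ‖v z‖ ^ 2 ≤ Iw := by
    have e : ∫ z in G, W z * ‖v z‖ ^ 2 = ∫ z in G, W z * ‖w z‖ ^ 2 :=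
      setIntegral_congr_fun hGm fun z hz => by simp [hw, hG1 z hz]
    rw [e]
    refine setIntegral_le_integral iw (Eventually.of_forall fun z => ?_)
    by_cases hz : z ∈ tsupport η
    · exact mul_nonneg (hW0 z (hTΩ hz)) (sq_nonneg _)
    · simp [hw0 z hz]
  linarith [hchain, h6, hI0w, hI0g, hJ10, hJ20, hJ30, hG]


set_option maxHeartbeats 800000 in
-- the assembly of many weighted integrals is long but elementary
/-- **First Carleman inequality with cut-offs** (the common core of Seregin 2014, Lemma A.1,
(A.2.7)–(A.2.10), and Lemma A.2, (A.3.11)): there are `κ > 0` and `C > 0`, depending only on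
`dim E`, with the following property. Let `0 < s₁ < s₂ ≤ 1/2`, `ρ ≥ 2`, `a ≥ 2`; let `v` be `C¹`, with every `∂ₑv ∈ C¹`,
on an open set `O ⊇ [s₁, 7/4] × B̄(0, ρ - 1/2)` and satisfy there `|∂ₛv + Δv| ≤ c (|v| + |∇v|)`
with `c² ≤ κ`. Then for every measurable `G ⊆ [s₂, 3/2] × B̄(0, ρ - 1)`,
`∫_G W|v|² ≤ C ((s₂ - s₁)⁻² ∫_{[s₁,s₂]×B̄(0,ρ-1/2)} W|v|² + ∫_ω W(|v|² + |∇v|²))`,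
where `W = h^{-2a}(s)e^{-|y|²/4s}` is the Carleman weight and `ω` the union of the top layer
`[3/2, 7/4] × B̄(0, ρ-1/2)` and the annulus `[s₁, 7/4] × (B̄(0, ρ-1/2) ∖ B(0, ρ-1))`
(`carleman_first_smul_le` for the cut-off `η = φ_b φ_t φ_ρ` of `exists_cutoff_first`, and the
pointwise bounds on `∂ₛη`, `∇η`, `Δη` there). [cite: Seregin2014, App. A.3, proof of Lemma A.2, (A.3.11)–(A.3.13)] -/
theorem core_first_c12 : ∃ κ C : ℝ, 0 < κ ∧ 0 < C ∧
    ∀ (c a s₁ s₂ ρ : ℝ) (v : ℝ × E → F) (O : Set (ℝ × E)),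
      IsOpen O → Icc s₁ (7 / 4) ×ˢ closedBall (0 : E) (ρ - 1 / 2) ⊆ O → ContDiffOn ℝ 1 v O →
      (∀ e : E, ContDiffOn ℝ 1 (dx e v) O) →
      (∀ z ∈ O, ‖dt v z + lap v z‖ ≤ c * (‖v z‖ + Real.sqrt (gradSq v z))) →
      c ^ 2 ≤ κ → 0 < s₁ → s₁ < s₂ → s₂ ≤ 1 / 2 → 2 ≤ ρ → 2 ≤ a →
      ∀ G ⊆ Icc s₂ (3 / 2) ×ˢ closedBall (0 : E) (ρ - 1), MeasurableSet G →
      ∫ z in G, carlemanWeight a z * ‖v z‖ ^ 2 ≤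
        C * ((s₂ - s₁)⁻¹ ^ 2 *
            (∫ z in Icc s₁ s₂ ×ˢ closedBall (0 : E) (ρ - 1 / 2), carlemanWeight a z * ‖v z‖ ^ 2) +
          ∫ z in (Icc (3 / 2) (7 / 4) ×ˢ closedBall (0 : E) (ρ - 1 / 2)) ∪
              (Icc s₁ (7 / 4) ×ˢ (closedBall (0 : E) (ρ - 1 / 2) \ ball 0 (ρ - 1))),
            carlemanWeight a z * (‖v z‖ ^ 2 + gradSq v z)) := by
  obtain ⟨D, G₀, L, hD, hG₀, hL, hcut⟩ := exists_cutoff_first E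
  set c₀ : ℝ := 11 * Real.exp (4 / 3) with hc₀
  have hc₀0 : 0 < c₀ := by positivity
  refine ⟨1 / (24 * c₀), 24 * c₀ * D ^ 2 + G₀ + 12 * c₀ * L ^ 2 + 24 * c₀ * G₀ + 1,
    by positivity, by positivity, ?_⟩
  intro c a s₁ s₂ ρ v O hO hKO hv hvx hBH hcκ hs₁ hs₁₂ hs₂ hρ ha G hG hGm
  -- ### the sets
  set K : Set (ℝ × E) := Icc s₁ (7 / 4) ×ˢ closedBall (0 : E) (ρ - 1 / 2) with hK
  set Sbot : Set (ℝ × E) := Icc s₁ s₂ ×ˢ closedBall (0 : E) (ρ - 1 / 2) with hSbot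
  set Stop : Set (ℝ × E) := Icc (3 / 2 : ℝ) (7 / 4) ×ˢ closedBall (0 : E) (ρ - 1 / 2) with hStop
  set Sann : Set (ℝ × E) := Icc s₁ (7 / 4) ×ˢ (closedBall (0 : E) (ρ - 1 / 2) \ ball 0 (ρ - 1))
    with hSann
  have hKc : IsCompact K := isCompact_Icc.prod (isCompact_closedBall _ _)
  have hbotK : Sbot ⊆ K := Set.prod_mono (Icc_subset_Icc_right (by linarith)) Subset.rfl
  have htopK : Stop ⊆ K := Set.prod_mono (Icc_subset_Icc_left (by linarith)) Subset.rfl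
  have hannK : Sann ⊆ K := Set.prod_mono Subset.rfl Set.sdiff_subset
  have hbotm : MeasurableSet Sbot := measurableSet_Icc.prod measurableSet_closedBall
  have htopm : MeasurableSet Stop := measurableSet_Icc.prod measurableSet_closedBall
  have hannm : MeasurableSet Sann :=
    measurableSet_Icc.prod (measurableSet_closedBall.diff measurableSet_ball)
  have hunm : MeasurableSet (Stop ∪ Sann) := htopm.union hannm
  set Ω : Set (ℝ × E) := {z | s₁ / 2 < z.1} with hΩ
  have hKΩ : K ⊆ Ω := fun z hz => by
    show s₁ / 2 < z.1
    linarith [hz.1.1]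
  set W : ℝ × E → ℝ := carlemanWeight a with hWdef
  have hWc : ContinuousOn W Ω := continuousOn_carlemanWeight a hs₁
  have hW0 : ∀ z ∈ Ω, 0 ≤ W z := fun z hz => (carlemanWeight_pos a (lt_trans (by positivity) hz)).le
  -- ### the cut-off
  obtain ⟨η, hηs, hη1, hηK, hηc, hηnn, hηle, hηdt, hηgrad, hηlap⟩ := hcut s₁ s₂ ρ hs₁ hs₁₂ hρ
  have hη2 : ContDiff ℝ 2 η := hηs.of_le (by norm_cast)
  have hηd0 : ∀ z ∉ tsupport η, fderiv ℝ η z = 0 := fun z hz =>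
    fderiv_of_notMem_tsupport (𝕜 := ℝ) hz
  have hgη0 : ∀ z ∉ tsupport η, gradSq η z = 0 := fun z hz => by simp [gradSq, dx, hηd0 z hz]
  have hlapη0 : ∀ z ∉ tsupport η, lap η z = 0 := fun z hz =>
    image_eq_zero_of_notMem_tsupport fun h => hz (tsupport_lap_subset η h)
  have hdtη0 : ∀ z ∉ tsupport η, dt η z = 0 := fun z hz => by simp [dt, hηd0 z hz]
  -- ### the Carleman estimate for `η v`
  have hmain := carleman_first_smul_le_c12 hO hs₁ hKO hv hvx hBH hcκ ha hη2 hηc hηK hηnn hGm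
    fun z hz => hη1 z (hG hz)
  -- ### integrability on `K`
  have cvO : ContinuousOn v O := hv.continuousOn
  have cgvO : ContinuousOn (gradSq v) O := by
    have hf : ContinuousOn (fderiv ℝ v) O := hv.continuousOn_fderiv_of_isOpen hO le_rfl
    show ContinuousOn (fun z => gradSq v z) O
    simp only [gradSq, dx]
    exact continuousOn_finsetSum _ fun i _ => ((hf.clm_apply continuousOn_const).norm.pow 2)
  have hWK : ContinuousOn W K := hWc.mono hKΩ
  have hIvK : IntegrableOn (fun z => W z * ‖v z‖ ^ 2) K :=
    (hWK.mul ((cvO.mono hKO).norm.pow 2)).integrableOn_compact hKc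
  have hIgK : IntegrableOn (fun z => W z * gradSq v z) K :=
    (hWK.mul (cgvO.mono hKO)).integrableOn_compact hKc
  have hind : ∀ {S : Set (ℝ × E)}, S ⊆ K → MeasurableSet S → ∀ (k : ℝ) {q : ℝ × E → ℝ},
      IntegrableOn (fun z => W z * q z) K →
      Integrable fun z => S.indicator (fun _ => k) z * (W z * q z) := by
    intro S hS hSm k q hq
    have h : Integrable (S.indicator fun z => k * (W z * q z)) :=
      IntegrableOn.integrable_indicator ((hq.mono_set hS).const_mul k) hSm
    refine h.congr (Eventually.of_forall fun z => ?_)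
    by_cases hz : z ∈ S <;> simp [hz]
  -- nonnegativity of indicator terms
  have hnn : ∀ {S : Set (ℝ × E)}, S ⊆ K → ∀ {k : ℝ}, 0 ≤ k → ∀ {q : ℝ × E → ℝ},
      (∀ z, 0 ≤ q z) → ∀ z, 0 ≤ S.indicator (fun _ => k) z * (W z * q z) := by
    intro S hS k hk q hq z
    by_cases hz : z ∈ S
    · rw [Set.indicator_of_mem hz]
      exact mul_nonneg hk (mul_nonneg (hW0 z (hKΩ (hS hz))) (hq z))
    · simp [hz]
  -- the four region integrals
  set Tbot : ℝ := ∫ z in Sbot, W z * ‖v z‖ ^ 2 with hTbot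
  set Ttop : ℝ := ∫ z in Stop, W z * ‖v z‖ ^ 2 with hTtop
  set Tann1 : ℝ := ∫ z in Sann, W z * ‖v z‖ ^ 2 with hTann1
  set Tann2 : ℝ := ∫ z in Sann, W z * gradSq v z with hTann2
  set U : ℝ := ∫ z in Stop ∪ Sann, W z * (‖v z‖ ^ 2 + gradSq v z) with hU
  -- ### (1) `J1 ≤ G₀ Tann1`
  have hJ1 : ∫ z, W z * (gradSq η z * ‖v z‖ ^ 2) ≤ G₀ * Tann1 := by
    rw [hTann1, ← integral_indicator_const_mul hannm]
    refine integral_mono_of_nonneg (Eventually.of_forall fun z => ?_) (hind hannK hannm G₀ hIvK)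
      (Eventually.of_forall fun z => ?_)
    · dsimp only
      by_cases hz : z ∈ tsupport η
      · exact mul_nonneg (hW0 z (hKΩ (hηK hz))) (mul_nonneg (gradSq_nonneg η z) (sq_nonneg _))
      · simp [hgη0 z hz]
    · dsimp only
      by_cases hz : z ∈ tsupport η
      · have hWz := hW0 z (hKΩ (hηK hz))
        have h := mul_le_mul_of_nonneg_right (hηgrad z) (mul_nonneg hWz (sq_nonneg ‖v z‖))
        calc W z * (gradSq η z * ‖v z‖ ^ 2) = gradSq η z * (W z * ‖v z‖ ^ 2) := by ring
          _ ≤ _ := h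
      · rw [hgη0 z hz]
        simpa using hnn hannK hG₀ (fun z => sq_nonneg ‖v z‖) z
  -- ### (2) `J3 ≤ G₀ Tann2`
  have hJ3 : ∫ z, W z * (gradSq η z * gradSq v z) ≤ G₀ * Tann2 := by
    rw [hTann2, ← integral_indicator_const_mul hannm]
    refine integral_mono_of_nonneg (Eventually.of_forall fun z => ?_) (hind hannK hannm G₀ hIgK)
      (Eventually.of_forall fun z => ?_)
    · dsimp only
      by_cases hz : z ∈ tsupport η
      · exact mul_nonneg (hW0 z (hKΩ (hηK hz)))
          (mul_nonneg (gradSq_nonneg η z) (gradSq_nonneg v z))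
      · simp [hgη0 z hz]
    · dsimp only
      by_cases hz : z ∈ tsupport η
      · have hWz := hW0 z (hKΩ (hηK hz))
        have h := mul_le_mul_of_nonneg_right (hηgrad z) (mul_nonneg hWz (gradSq_nonneg v z))
        calc W z * (gradSq η z * gradSq v z) = gradSq η z * (W z * gradSq v z) := by ring
          _ ≤ _ := h
      · rw [hgη0 z hz]
        simpa using hnn hannK hG₀ (fun z => gradSq_nonneg v z) z
  -- ### (3) `J2 ≤ 4(D/(s₂-s₁))² Tbot + 4D² Ttop + 2L² Tann1`
  have hs21 : 0 < s₂ - s₁ := sub_pos.2 hs₁₂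
  have hJ2 : ∫ z, W z * ((dt η z + lap η z) ^ 2 * ‖v z‖ ^ 2) ≤
      4 * ((D / (s₂ - s₁)) ^ 2 * Tbot) + 4 * (D ^ 2 * Ttop) + 2 * (L ^ 2 * Tann1) := by
    have i1 := hind hbotK hbotm ((D / (s₂ - s₁)) ^ 2) hIvK
    have i2 := hind htopK htopm (D ^ 2) hIvK
    have i3 := hind hannK hannm (L ^ 2) hIvK
    have hmono : ∫ z, W z * ((dt η z + lap η z) ^ 2 * ‖v z‖ ^ 2) ≤
        ∫ z, (4 * (Sbot.indicator (fun _ => (D / (s₂ - s₁)) ^ 2) z * (W z * ‖v z‖ ^ 2)) +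
          4 * (Stop.indicator (fun _ => D ^ 2) z * (W z * ‖v z‖ ^ 2)) +
          2 * (Sann.indicator (fun _ => L ^ 2) z * (W z * ‖v z‖ ^ 2))) := by
      refine integral_mono_of_nonneg (Eventually.of_forall fun z => ?_)
        (((i1.const_mul 4).add (i2.const_mul 4)).add (i3.const_mul 2))
        (Eventually.of_forall fun z => ?_)
      · dsimp only
        by_cases hz : z ∈ tsupport η
        · exact mul_nonneg (hW0 z (hKΩ (hηK hz))) (mul_nonneg (sq_nonneg _) (sq_nonneg _))
        · rw [hdtη0 z hz, hlapη0 z hz]; simp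
      · dsimp only
        have n1 := hnn hbotK (by positivity : 0 ≤ (D / (s₂ - s₁)) ^ 2) (fun z => sq_nonneg ‖v z‖) z
        have n2 := hnn htopK (by positivity : 0 ≤ D ^ 2) (fun z => sq_nonneg ‖v z‖) z
        have n3 := hnn hannK (by positivity : 0 ≤ L ^ 2) (fun z => sq_nonneg ‖v z‖) z
        by_cases hz : z ∈ tsupport η
        swap
        · rw [hdtη0 z hz, hlapη0 z hz]
          simp only [add_zero, zero_pow two_ne_zero, zero_mul, mul_zero]
          positivity
        have hWz := hW0 z (hKΩ (hηK hz))
        -- squares of the indicator bounds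
        have e1 : (Sbot.indicator (fun _ => D / (s₂ - s₁)) z) ^ 2 =
            Sbot.indicator (fun _ => (D / (s₂ - s₁)) ^ 2) z := by
          by_cases h : z ∈ Sbot <;> simp [h]
        have e2 : (Stop.indicator (fun _ => D) z) ^ 2 = Stop.indicator (fun _ => D ^ 2) z := by
          by_cases h : z ∈ Stop <;> simp [h]
        have e3 : (Sann.indicator (fun _ => L) z) ^ 2 = Sann.indicator (fun _ => L ^ 2) z := by
          by_cases h : z ∈ Sann <;> simp [h]
        have hb : |dt η z + lap η z| ≤ Sbot.indicator (fun _ => D / (s₂ - s₁)) z +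
            Stop.indicator (fun _ => D) z + Sann.indicator (fun _ => L) z :=
          (abs_add_le _ _).trans (add_le_add (hηdt z) (hηlap z))
        have hsq : (dt η z + lap η z) ^ 2 ≤
            4 * Sbot.indicator (fun _ => (D / (s₂ - s₁)) ^ 2) z +
            4 * Stop.indicator (fun _ => D ^ 2) z + 2 * Sann.indicator (fun _ => L ^ 2) z := by
          rw [← e1, ← e2, ← e3, ← sq_abs (dt η z + lap η z)]
          exact (pow_le_pow_left₀ (abs_nonneg _) hb 2).trans (add_three_sq_le' _ _ _)
        have := mul_le_mul_of_nonneg_right hsq (mul_nonneg hWz (sq_nonneg ‖v z‖))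
        calc W z * ((dt η z + lap η z) ^ 2 * ‖v z‖ ^ 2)
            = (dt η z + lap η z) ^ 2 * (W z * ‖v z‖ ^ 2) := by ring
          _ ≤ _ := this
          _ = _ := by ring
    have e1 : ∫ z, (4 * (Sbot.indicator (fun _ => (D / (s₂ - s₁)) ^ 2) z * (W z * ‖v z‖ ^ 2)) +
          4 * (Stop.indicator (fun _ => D ^ 2) z * (W z * ‖v z‖ ^ 2)) +
          2 * (Sann.indicator (fun _ => L ^ 2) z * (W z * ‖v z‖ ^ 2))) =
        (∫ z, (4 * (Sbot.indicator (fun _ => (D / (s₂ - s₁)) ^ 2) z * (W z * ‖v z‖ ^ 2)) +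
          4 * (Stop.indicator (fun _ => D ^ 2) z * (W z * ‖v z‖ ^ 2)))) +
        ∫ z, 2 * (Sann.indicator (fun _ => L ^ 2) z * (W z * ‖v z‖ ^ 2)) :=
      integral_add ((i1.const_mul 4).add (i2.const_mul 4)) (i3.const_mul 2)
    have e2 : ∫ z, (4 * (Sbot.indicator (fun _ => (D / (s₂ - s₁)) ^ 2) z * (W z * ‖v z‖ ^ 2)) +
          4 * (Stop.indicator (fun _ => D ^ 2) z * (W z * ‖v z‖ ^ 2))) =
        (∫ z, 4 * (Sbot.indicator (fun _ => (D / (s₂ - s₁)) ^ 2) z * (W z * ‖v z‖ ^ 2))) +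
        ∫ z, 4 * (Stop.indicator (fun _ => D ^ 2) z * (W z * ‖v z‖ ^ 2)) :=
      integral_add (i1.const_mul 4) (i2.const_mul 4)
    have e3 : ∫ z, 4 * (Sbot.indicator (fun _ => (D / (s₂ - s₁)) ^ 2) z * (W z * ‖v z‖ ^ 2)) =
        4 * ((D / (s₂ - s₁)) ^ 2 * Tbot) := by
      rw [integral_const_mul, integral_indicator_const_mul hbotm]
    have e4 : ∫ z, 4 * (Stop.indicator (fun _ => D ^ 2) z * (W z * ‖v z‖ ^ 2)) =
        4 * (D ^ 2 * Ttop) := by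
      rw [integral_const_mul, integral_indicator_const_mul htopm]
    have e5 : ∫ z, 2 * (Sann.indicator (fun _ => L ^ 2) z * (W z * ‖v z‖ ^ 2)) =
        2 * (L ^ 2 * Tann1) := by
      rw [integral_const_mul, integral_indicator_const_mul hannm]
    rw [e1, e2, e3, e4, e5] at hmono
    exact hmono
  -- ### (4) the region integrals are dominated by `U`
  have hIU : IntegrableOn (fun z => W z * (‖v z‖ ^ 2 + gradSq v z)) (Stop ∪ Sann) := by
    have := (hIvK.add hIgK).mono_set (union_subset htopK hannK)
    exact this.congr_fun (fun z _ => by simp only [Pi.add_apply]; ring) hunm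
  have hle : ∀ {S : Set (ℝ × E)}, S ⊆ Stop ∪ Sann → MeasurableSet S →
      ∀ {q : ℝ × E → ℝ}, IntegrableOn (fun z => W z * q z) K → (∀ z, 0 ≤ q z) →
      (∀ z, q z ≤ ‖v z‖ ^ 2 + gradSq v z) → ∫ z in S, W z * q z ≤ U := by
    intro S hS hSm q hq hq0 hq1
    have hSK : S ⊆ K := hS.trans (union_subset htopK hannK)
    calc ∫ z in S, W z * q z ≤ ∫ z in S, W z * (‖v z‖ ^ 2 + gradSq v z) :=
          setIntegral_mono_on (hq.mono_set hSK) (hIU.mono_set hS) hSm fun z hz =>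
            mul_le_mul_of_nonneg_left (hq1 z) (hW0 z (hKΩ (hSK hz)))
      _ ≤ U := by
          refine setIntegral_mono_set hIU ?_ (Eventually.of_forall hS)
          refine ae_restrict_of_forall_mem hunm fun z hz => ?_
          exact mul_nonneg (hW0 z (hKΩ (union_subset htopK hannK hz)))
            (add_nonneg (sq_nonneg _) (gradSq_nonneg v z))
  have hq1a : ∀ z, ‖v z‖ ^ 2 ≤ ‖v z‖ ^ 2 + gradSq v z := fun z =>
    le_add_of_nonneg_right (gradSq_nonneg v z)
  have hq1b : ∀ z, gradSq v z ≤ ‖v z‖ ^ 2 + gradSq v z := fun z =>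
    le_add_of_nonneg_left (sq_nonneg _)
  have hTtopU : Ttop ≤ U := hle subset_union_left htopm hIvK (fun z => sq_nonneg _) hq1a
  have hTann1U : Tann1 ≤ U := hle subset_union_right hannm hIvK (fun z => sq_nonneg _) hq1a
  have hTann2U : Tann2 ≤ U := hle subset_union_right hannm hIgK (fun z => gradSq_nonneg v z) hq1b
  -- nonnegativity of `Tbot`, `U`
  have hTbot0 : 0 ≤ Tbot := setIntegral_nonneg hbotm fun z hz =>
    mul_nonneg (hW0 z (hKΩ (hbotK hz))) (sq_nonneg _)
  have hU0 : 0 ≤ U := setIntegral_nonneg hunm fun z hz =>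
    mul_nonneg (hW0 z (hKΩ (union_subset htopK hannK hz)))
      (add_nonneg (sq_nonneg _) (gradSq_nonneg v z))
  -- ### (5) assembly
  have hdiv : (D / (s₂ - s₁)) ^ 2 = D ^ 2 * (s₂ - s₁)⁻¹ ^ 2 := by
    rw [div_eq_mul_inv, mul_pow]
  have h1 : G₀ * Tann1 ≤ G₀ * U := mul_le_mul_of_nonneg_left hTann1U hG₀
  have h2 : D ^ 2 * Ttop ≤ D ^ 2 * U := mul_le_mul_of_nonneg_left hTtopU (sq_nonneg _)
  have h3 : L ^ 2 * Tann1 ≤ L ^ 2 * U := mul_le_mul_of_nonneg_left hTann1U (sq_nonneg _)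
  have h4 : G₀ * Tann2 ≤ G₀ * U := mul_le_mul_of_nonneg_left hTann2U hG₀
  have hX0 : 0 ≤ (s₂ - s₁)⁻¹ ^ 2 * Tbot := mul_nonneg (sq_nonneg _) hTbot0
  have key1 : 24 * c₀ * (D ^ 2 * (s₂ - s₁)⁻¹ ^ 2 * Tbot) ≤
      (24 * c₀ * D ^ 2 + G₀ + 12 * c₀ * L ^ 2 + 24 * c₀ * G₀ + 1) * ((s₂ - s₁)⁻¹ ^ 2 * Tbot) := by
    rw [show 24 * c₀ * (D ^ 2 * (s₂ - s₁)⁻¹ ^ 2 * Tbot) =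
      (24 * c₀ * D ^ 2) * ((s₂ - s₁)⁻¹ ^ 2 * Tbot) by ring]
    exact mul_le_mul_of_nonneg_right (by nlinarith [hc₀0.le, hG₀, sq_nonneg L]) hX0
  have key2 : (24 * c₀ * D ^ 2 + G₀ + 12 * c₀ * L ^ 2 + 24 * c₀ * G₀) * U ≤
      (24 * c₀ * D ^ 2 + G₀ + 12 * c₀ * L ^ 2 + 24 * c₀ * G₀ + 1) * U :=
    mul_le_mul_of_nonneg_right (by linarith) hU0
  rw [hdiv] at hJ2
  have hJ2' := mul_le_mul_of_nonneg_left hJ2 (by positivity : (0 : ℝ) ≤ 6 * (11 * Real.exp (4 / 3)))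
  have hJ3' := mul_le_mul_of_nonneg_left hJ3 (by positivity : (0 : ℝ) ≤ 24 * (11 * Real.exp (4 / 3)))
  have h2' := mul_le_mul_of_nonneg_left h2 (by positivity : (0 : ℝ) ≤ 24 * c₀)
  have h3' := mul_le_mul_of_nonneg_left h3 (by positivity : (0 : ℝ) ≤ 12 * c₀)
  have h4' := mul_le_mul_of_nonneg_left h4 (by positivity : (0 : ℝ) ≤ 24 * c₀)
  simp only [← hc₀] at hJ2' hJ3' hmain
  linarith [hmain, hJ1, hJ2', hJ3', h1, h2', h3', h4', key1, key2]


end CoreFirstC12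

/-! ### The second Carleman inequality with cut-offs, in the class -/

section CoreSecondC12

variable {E : Type*} [NormedAddCommGroup E] [InnerProductSpace ℝ E] [FiniteDimensional ℝ E]
  [MeasurableSpace E] [BorelSpace E]
variable {F : Type*} [NormedAddCommGroup F] [InnerProductSpace ℝ F] [CompleteSpace F]

set_option maxHeartbeats 800000 in
/-- **The second Carleman inequality for `w = ηv`, with the lower-order terms absorbed**
(Seregin 2014, p. 213): let `a ≥ 2`, `e` a unit vector, `η ∈ C²_c` with
`tsupport η ⊆ ]0, 1[ × {⟪y, e⟫ > 1}` and `tsupport η ⊆ O`, `η ≥ 0`, and `v ∈ C¹(O)`, `∂ₑv ∈ C¹(O)` (`O` open)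
with `|∂ₛv + Δv| ≤ c(|v| + |∇v|)` on `O`, `c² ≤ 1/(24 · 11)`. Then, with
`W₂ = s² exp(2 φ_a)`, `φ_a = phiKR a k_{3/4} ρ_{3/4} e`, for every measurable `G` on which `η = 1`,
`∫_G W₂|v|² ≤ ∫ W₂|∇η|²|v|² + 66 ∫ W₂(∂ₛη + Δη)²|v|² + 264 ∫ W₂|∇η|²|∇v|²`. [cite: Seregin2014, App. A.3, proof of Lemma A.3] -/
theorem carleman_second_smul_le_c12 {η : ℝ × E → ℝ} {v : ℝ × E → F} {O : Set (ℝ × E)} {e : E}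
    {c a : ℝ} (he : ‖e‖ = 1) (hO : IsOpen O) (hv : ContDiffOn ℝ 1 v O)
    (hvx : ∀ e : E, ContDiffOn ℝ 1 (dx e v) O)
    (hBH : ∀ z ∈ O, ‖dt v z + lap v z‖ ≤ c * (‖v z‖ + Real.sqrt (gradSq v z)))
    (hcκ : c ^ 2 ≤ 1 / (24 * 11)) (ha : 2 ≤ a)
    (hη : ContDiff ℝ 2 η) (hηc : HasCompactSupport η)
    (hηs : tsupport η ⊆ Ioo (0 : ℝ) 1 ×ˢ {x : E | 1 < ⟪x, e⟫}) (hηO : tsupport η ⊆ O)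
    (hη0 : ∀ z, 0 ≤ η z) {G : Set (ℝ × E)} (hGm : MeasurableSet G) (hG1 : ∀ z ∈ G, η z = 1) :
    ∫ z in G, z.1 ^ 2 * Real.exp (2 * phiKR a (kA (3 / 4)) (rhoA (3 / 4)) e z) * ‖v z‖ ^ 2 ≤
      (∫ z, z.1 ^ 2 * Real.exp (2 * phiKR a (kA (3 / 4)) (rhoA (3 / 4)) e z) *
        (gradSq η z * ‖v z‖ ^ 2)) +
      6 * 11 * (∫ z, z.1 ^ 2 * Real.exp (2 * phiKR a (kA (3 / 4)) (rhoA (3 / 4)) e z) *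
        ((dt η z + lap η z) ^ 2 * ‖v z‖ ^ 2)) +
      24 * 11 * ∫ z, z.1 ^ 2 * Real.exp (2 * phiKR a (kA (3 / 4)) (rhoA (3 / 4)) e z) *
        (gradSq η z * gradSq v z) := by
  obtain ⟨c₀, hc₀⟩ : ∃ c₀ : ℝ, c₀ = 11 := ⟨_, rfl⟩
  have hc₀0 : 0 < c₀ := by rw [hc₀]; norm_num
  -- ### geometry
  set Ω : Set (ℝ × E) := Ioo (0 : ℝ) 1 ×ˢ {x : E | 1 < ⟪x, e⟫} with hΩ
  have hΩo : IsOpen Ω :=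
    isOpen_Ioo.prod (isOpen_lt continuous_const (continuous_id.inner continuous_const))
  have hΩh : Ω ⊆ halfDom e := fun z hz => ⟨hz.1.1, lt_trans zero_lt_one hz.2⟩
  have hTc : IsCompact (tsupport η) := hηc
  have hTΩ : tsupport η ⊆ Ω := hηs
  have hTO : tsupport η ⊆ O := hηO
  set W : ℝ × E → ℝ := fun z => z.1 ^ 2 * Real.exp (2 * phiKR a (kA (3 / 4)) (rhoA (3 / 4)) e z)
    with hWdef
  have cφ : ContinuousOn (phiKR a (kA (3 / 4)) (rhoA (3 / 4)) e) Ω :=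
    (contDiffOn_phiKR (contDiffOn_kA _) (contDiffOn_rhoA _) a e).continuousOn.mono hΩh
  have hWc : ContinuousOn W Ω :=
    (continuous_fst.pow 2).continuousOn.mul (continuousOn_const.mul cφ).rexp
  have hW0 : ∀ z, 0 ≤ W z := fun z => mul_nonneg (sq_nonneg _) (Real.exp_pos _).le
  -- ### `w = η v`
  set w : ℝ × E → F := fun z => η z • v z with hw
  have hw0 : ∀ z ∉ tsupport η, w z = 0 := fun z hz => by
    simp [hw, image_eq_zero_of_notMem_tsupport hz]
  have hwK : tsupport w ⊆ tsupport η := by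
    refine closure_minimal (fun z hz => ?_) (isClosed_tsupport η)
    by_contra h
    exact hz (hw0 z h)
  have hw1 : ContDiff ℝ 1 w := contDiff_one_cutoff_smul_c12 hO hη hTO hv
  have hwx : ∀ e' : E, ContDiff ℝ 1 (dx e' w) := fun e' =>
    contDiff_one_dx_cutoff_smul_c12 hO hη hTO hv hvx e'
  have hwc : HasCompactSupport w := hηc.mono' ((subset_tsupport _).trans hwK)
  have hws : tsupport w ⊆ Ioo (0 : ℝ) 1 ×ˢ {x : E | 1 < ⟪x, e⟫} := hwK.trans hηs
  -- ### vanishing off `tsupport η`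
  have hηd0 : ∀ z ∉ tsupport η, fderiv ℝ η z = 0 := fun z hz =>
    fderiv_of_notMem_tsupport (𝕜 := ℝ) hz
  have hgη0 : ∀ z ∉ tsupport η, gradSq η z = 0 := fun z hz => by simp [gradSq, dx, hηd0 z hz]
  have hlapη0 : ∀ z ∉ tsupport η, lap η z = 0 := fun z hz =>
    image_eq_zero_of_notMem_tsupport fun h => hz (tsupport_lap_subset η h)
  have hdtη0 : ∀ z ∉ tsupport η, dt η z = 0 := fun z hz => by simp [dt, hηd0 z hz]
  have hwd0 : ∀ z ∉ tsupport η, fderiv ℝ w z = 0 := fun z hz =>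
    fderiv_of_notMem_tsupport (𝕜 := ℝ) fun h => hz (hwK h)
  have hgw0 : ∀ z ∉ tsupport η, gradSq w z = 0 := fun z hz => by simp [gradSq, dx, hwd0 z hz]
  have hlapw0 : ∀ z ∉ tsupport η, lap w z = 0 := fun z hz =>
    image_eq_zero_of_notMem_tsupport fun h => hz (hwK (tsupport_lap_subset w h))
  have hdtw0 : ∀ z ∉ tsupport η, dt w z = 0 := fun z hz => by simp [dt, hwd0 z hz]
  have hPw0 : ∀ z ∉ tsupport η, dt w z + lap w z = 0 := fun z hz => by
    rw [hdtw0 z hz, hlapw0 z hz, add_zero]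
  -- ### continuity
  have cw : Continuous w := hw1.continuous
  have cfdr : ∀ {f : ℝ × E → ℝ}, ContDiff ℝ 2 f → ∀ u : ℝ × E, Continuous fun z => fderiv ℝ f z u :=
    fun hf u => (hf.continuous_fderiv (by norm_num)).clm_apply continuous_const
  have cfd2r : ∀ {f : ℝ × E → ℝ}, ContDiff ℝ 2 f → ∀ u u' : ℝ × E,
      Continuous fun z => fderiv ℝ (fun y => fderiv ℝ f y u) z u' := by
    intro f hf u u'
    have h1 : ContDiff ℝ 1 fun y => fderiv ℝ f y u :=
      (hf.fderiv_right (m := 1) le_rfl).clm_apply contDiff_const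
    exact (h1.continuous_fderiv one_ne_zero).clm_apply continuous_const
  have cPw : Continuous fun z => dt w z + lap w z := continuous_dt_add_lap_c12 hw1 hwx
  have cgw : Continuous (gradSq w) := continuous_gradSq_of_one hw1
  have cPη : Continuous fun z => dt η z + lap η z := by
    simp only [dt, lap, dx]
    exact (cfdr hη _).add (continuous_finsetSum _ fun i _ => cfd2r hη _ _)
  have cgη : Continuous (gradSq η) := by
    show Continuous fun z => gradSq η z
    simp only [gradSq, dx]
    exact continuous_finsetSum _ fun i _ => ((cfdr hη _).norm.pow 2)
  have cvO : ContinuousOn v O := hv.continuousOn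
  have cgvO : ContinuousOn (gradSq v) O := by
    have hf : ContinuousOn (fderiv ℝ v) O := hv.continuousOn_fderiv_of_isOpen hO le_rfl
    show ContinuousOn (fun z => gradSq v z) O
    simp only [gradSq, dx]
    exact continuousOn_finsetSum _ fun i _ => ((hf.clm_apply continuousOn_const).norm.pow 2)
  -- ### integrability of all the weighted integrands
  have iw : Integrable fun z => W z * ‖w z‖ ^ 2 :=
    integrable_weight_mul hΩo hTc hTΩ hWc (cw.norm.pow 2) fun z hz => by simp [hw0 z hz]
  have igw : Integrable fun z => W z * gradSq w z :=
    integrable_weight_mul hΩo hTc hTΩ hWc cgw hgw0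
  have iPw : Integrable fun z => W z * ‖dt w z + lap w z‖ ^ 2 :=
    integrable_weight_mul hΩo hTc hTΩ hWc (cPw.norm.pow 2) fun z hz => by
      rw [hPw0 z hz]; simp
  have ct0 : ∀ z ∈ Ω, z.1 ≠ 0 := fun z hz => hz.1.1.ne'
  have hWs1 : ContinuousOn (fun z : ℝ × E => W z * (a / z.1 ^ 2)) Ω :=
    hWc.mul (continuousOn_const.div (continuous_fst.pow 2).continuousOn fun z hz =>
      pow_ne_zero _ (ct0 z hz))
  have hWs2 : ContinuousOn (fun z : ℝ × E => W z * (1 / z.1)) Ω :=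
    hWc.mul (continuousOn_const.div continuous_fst.continuousOn ct0)
  have iws1 : Integrable fun z => W z * (a / z.1 ^ 2) * ‖w z‖ ^ 2 :=
    integrable_weight_mul hΩo hTc hTΩ hWs1 (cw.norm.pow 2) fun z hz => by simp [hw0 z hz]
  have iws2 : Integrable fun z => W z * (1 / z.1) * gradSq w z :=
    integrable_weight_mul hΩo hTc hTΩ hWs2 cgw hgw0
  have iJ1 : Integrable fun z => W z * (gradSq η z * ‖v z‖ ^ 2) :=
    integrable_weight_mul hΩo hTc hTΩ hWc
      (continuous_mul_of_eq_zero_off hO (isClosed_tsupport η) hTO cgη hgη0 (cvO.norm.pow 2))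
      fun z hz => by simp [hgη0 z hz]
  have iJ2 : Integrable fun z => W z * ((dt η z + lap η z) ^ 2 * ‖v z‖ ^ 2) :=
    integrable_weight_mul hΩo hTc hTΩ hWc
      (continuous_mul_of_eq_zero_off hO (isClosed_tsupport η) hTO (cPη.pow 2)
        (fun z hz => by rw [hdtη0 z hz, hlapη0 z hz]; simp) (cvO.norm.pow 2))
      fun z hz => by rw [hdtη0 z hz, hlapη0 z hz]; simp
  have iJ3 : Integrable fun z => W z * (gradSq η z * gradSq v z) :=
    integrable_weight_mul hΩo hTc hTΩ hWc
      (continuous_mul_of_eq_zero_off hO (isClosed_tsupport η) hTO cgη hgη0 cgvO)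
      fun z hz => by simp [hgη0 z hz]
  -- ### the Carleman inequality and the lower bound of its left-hand side
  have hCarl0 := carleman_inequality_second_of_c12 (E := E) (F := F) (α := 3 / 4)
    (a := a) (by norm_num) (by norm_num) ha he hw1 hwx hwc hws
  have hc11 : (5 : ℝ) + 3 / (2 * (3 / 4) - 1) = c₀ := by rw [hc₀]; norm_num
  rw [hc11] at hCarl0
  have hCarl : ∫ z, W z * (a * ‖w z‖ ^ 2 / z.1 ^ 2 + gradSq w z / z.1) ≤
      c₀ * ∫ z, W z * ‖dt w z + lap w z‖ ^ 2 := hCarl0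
  have hLHS : (∫ z, W z * ‖w z‖ ^ 2) + (∫ z, W z * gradSq w z) ≤
      ∫ z, W z * (a * ‖w z‖ ^ 2 / z.1 ^ 2 + gradSq w z / z.1) := by
    have e0 : (∫ z, W z * ‖w z‖ ^ 2) + (∫ z, W z * gradSq w z) =
        ∫ z, (W z * ‖w z‖ ^ 2 + W z * gradSq w z) := (integral_add iw igw).symm
    rw [e0]
    have e : (fun z => W z * (a * ‖w z‖ ^ 2 / z.1 ^ 2 + gradSq w z / z.1)) =
        fun z => W z * (a / z.1 ^ 2) * ‖w z‖ ^ 2 + W z * (1 / z.1) * gradSq w z := by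
      funext z; ring
    rw [e]
    refine integral_mono (iw.add igw) (iws1.add iws2) fun z => ?_
    by_cases hz : z ∈ tsupport η
    · have hzΩ := hTΩ hz
      have hWz : 0 ≤ W z := hW0 z
      have hz0 : 0 < z.1 := hzΩ.1.1
      have hz1 : z.1 < 1 := hzΩ.1.2
      have hs1 : 1 ≤ a / z.1 ^ 2 := by
        rw [le_div_iff₀ (by positivity)]; nlinarith
      have hs2 : 1 ≤ 1 / z.1 := by
        rw [le_div_iff₀ hz0]; linarith
      have h1 : W z * ‖w z‖ ^ 2 ≤ W z * (a / z.1 ^ 2) * ‖w z‖ ^ 2 := by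
        have := mul_le_mul_of_nonneg_left hs1 (mul_nonneg hWz (sq_nonneg ‖w z‖))
        linarith [this]
      have h2 : W z * gradSq w z ≤ W z * (1 / z.1) * gradSq w z := by
        have := mul_le_mul_of_nonneg_left hs2 (mul_nonneg hWz (gradSq_nonneg w z))
        linarith [this]
      exact add_le_add h1 h2
    · simp [hw0 z hz, hgw0 z hz]
  -- ### the pointwise bound and its integral
  have hP : ∀ z, W z * ‖dt w z + lap w z‖ ^ 2 ≤
      6 * c ^ 2 * (W z * ‖w z‖ ^ 2 + 2 * (W z * gradSq w z) +
        2 * (W z * (gradSq η z * ‖v z‖ ^ 2))) +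
      3 * (W z * ((dt η z + lap η z) ^ 2 * ‖v z‖ ^ 2)) +
      12 * (W z * (gradSq η z * gradSq v z)) := by
    intro z
    by_cases hz : z ∈ tsupport η
    · have hWz : 0 ≤ W z := hW0 z
      have h := mul_le_mul_of_nonneg_left
        (norm_sq_dt_add_lap_smul_le_c12 hO hη hv hvx (hTO hz) (hη0 z) (hBH z (hTO hz))) hWz
      refine h.trans (le_of_eq ?_)
      simp only [hw]
      ring
    · rw [hPw0 z hz, hw0 z hz, hgw0 z hz, hgη0 z hz, hdtη0 z hz, hlapη0 z hz]
      simp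
  have hRHS : ∫ z, W z * ‖dt w z + lap w z‖ ^ 2 ≤
      6 * c ^ 2 * ((∫ z, W z * ‖w z‖ ^ 2) + 2 * (∫ z, W z * gradSq w z) +
        2 * ∫ z, W z * (gradSq η z * ‖v z‖ ^ 2)) +
      3 * (∫ z, W z * ((dt η z + lap η z) ^ 2 * ‖v z‖ ^ 2)) +
      12 * ∫ z, W z * (gradSq η z * gradSq v z) := by
    have iA0 : Integrable fun z => W z * ‖w z‖ ^ 2 + 2 * (W z * gradSq w z) +
        2 * (W z * (gradSq η z * ‖v z‖ ^ 2)) := (iw.add (igw.const_mul 2)).add (iJ1.const_mul 2)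
    have iA : Integrable fun z => 6 * c ^ 2 * (W z * ‖w z‖ ^ 2 + 2 * (W z * gradSq w z) +
        2 * (W z * (gradSq η z * ‖v z‖ ^ 2))) := iA0.const_mul _
    have iB : Integrable fun z => 3 * (W z * ((dt η z + lap η z) ^ 2 * ‖v z‖ ^ 2)) :=
      iJ2.const_mul 3
    have iC : Integrable fun z => 12 * (W z * (gradSq η z * gradSq v z)) := iJ3.const_mul 12
    have hmono : ∫ z, W z * ‖dt w z + lap w z‖ ^ 2 ≤
        ∫ z, (6 * c ^ 2 * (W z * ‖w z‖ ^ 2 + 2 * (W z * gradSq w z) +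
          2 * (W z * (gradSq η z * ‖v z‖ ^ 2))) +
          3 * (W z * ((dt η z + lap η z) ^ 2 * ‖v z‖ ^ 2)) +
          12 * (W z * (gradSq η z * gradSq v z))) := integral_mono iPw ((iA.add iB).add iC) hP
    have e1a : ∫ z, (6 * c ^ 2 * (W z * ‖w z‖ ^ 2 + 2 * (W z * gradSq w z) +
        2 * (W z * (gradSq η z * ‖v z‖ ^ 2))) +
        3 * (W z * ((dt η z + lap η z) ^ 2 * ‖v z‖ ^ 2)) +
        12 * (W z * (gradSq η z * gradSq v z))) =
        (∫ z, (6 * c ^ 2 * (W z * ‖w z‖ ^ 2 + 2 * (W z * gradSq w z) +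
          2 * (W z * (gradSq η z * ‖v z‖ ^ 2))) +
          3 * (W z * ((dt η z + lap η z) ^ 2 * ‖v z‖ ^ 2)))) +
        ∫ z, 12 * (W z * (gradSq η z * gradSq v z)) := integral_add (iA.add iB) iC
    have e1b : ∫ z, (6 * c ^ 2 * (W z * ‖w z‖ ^ 2 + 2 * (W z * gradSq w z) +
          2 * (W z * (gradSq η z * ‖v z‖ ^ 2))) +
          3 * (W z * ((dt η z + lap η z) ^ 2 * ‖v z‖ ^ 2))) =
        (∫ z, 6 * c ^ 2 * (W z * ‖w z‖ ^ 2 + 2 * (W z * gradSq w z) +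
          2 * (W z * (gradSq η z * ‖v z‖ ^ 2)))) +
        ∫ z, 3 * (W z * ((dt η z + lap η z) ^ 2 * ‖v z‖ ^ 2)) := integral_add iA iB
    have e2a : ∫ z, 6 * c ^ 2 * (W z * ‖w z‖ ^ 2 + 2 * (W z * gradSq w z) +
        2 * (W z * (gradSq η z * ‖v z‖ ^ 2))) =
        6 * c ^ 2 * ∫ z, (W z * ‖w z‖ ^ 2 + 2 * (W z * gradSq w z) +
          2 * (W z * (gradSq η z * ‖v z‖ ^ 2))) := integral_const_mul _ _
    have e2b : ∫ z, (W z * ‖w z‖ ^ 2 + 2 * (W z * gradSq w z) +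
        2 * (W z * (gradSq η z * ‖v z‖ ^ 2))) =
        (∫ z, (W z * ‖w z‖ ^ 2 + 2 * (W z * gradSq w z))) +
          ∫ z, 2 * (W z * (gradSq η z * ‖v z‖ ^ 2)) :=
      integral_add (iw.add (igw.const_mul 2)) (iJ1.const_mul 2)
    have e2c : ∫ z, (W z * ‖w z‖ ^ 2 + 2 * (W z * gradSq w z)) =
        (∫ z, W z * ‖w z‖ ^ 2) + ∫ z, 2 * (W z * gradSq w z) := integral_add iw (igw.const_mul 2)
    have e2d : ∫ z, 2 * (W z * gradSq w z) = 2 * ∫ z, W z * gradSq w z := integral_const_mul _ _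
    have e2e : ∫ z, 2 * (W z * (gradSq η z * ‖v z‖ ^ 2)) =
        2 * ∫ z, W z * (gradSq η z * ‖v z‖ ^ 2) := integral_const_mul _ _
    have e3 : ∫ z, 3 * (W z * ((dt η z + lap η z) ^ 2 * ‖v z‖ ^ 2)) =
        3 * ∫ z, W z * ((dt η z + lap η z) ^ 2 * ‖v z‖ ^ 2) := integral_const_mul _ _
    have e4 : ∫ z, 12 * (W z * (gradSq η z * gradSq v z)) =
        12 * ∫ z, W z * (gradSq η z * gradSq v z) := integral_const_mul _ _
    rw [e1a, e1b, e2a, e2b, e2c, e2d, e2e, e3, e4] at hmono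
    exact hmono
  -- ### absorption
  have hI0w : 0 ≤ ∫ z, W z * ‖w z‖ ^ 2 := integral_nonneg fun z => mul_nonneg (hW0 z) (sq_nonneg _)
  have hI0g : 0 ≤ ∫ z, W z * gradSq w z :=
    integral_nonneg fun z => mul_nonneg (hW0 z) (gradSq_nonneg w z)
  have hJ10 : 0 ≤ ∫ z, W z * (gradSq η z * ‖v z‖ ^ 2) :=
    integral_nonneg fun z => mul_nonneg (hW0 z) (mul_nonneg (gradSq_nonneg η z) (sq_nonneg _))
  have hJ20 : 0 ≤ ∫ z, W z * ((dt η z + lap η z) ^ 2 * ‖v z‖ ^ 2) :=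
    integral_nonneg fun z => mul_nonneg (hW0 z) (mul_nonneg (sq_nonneg _) (sq_nonneg _))
  have hJ30 : 0 ≤ ∫ z, W z * (gradSq η z * gradSq v z) :=
    integral_nonneg fun z => mul_nonneg (hW0 z) (mul_nonneg (gradSq_nonneg η z) (gradSq_nonneg v z))
  have hcc : 6 * c₀ * c ^ 2 ≤ 1 / 4 := by
    have h := mul_le_mul_of_nonneg_left hcκ (by positivity : (0 : ℝ) ≤ 6 * c₀)
    rw [show 6 * c₀ * (1 / (24 * 11)) = 1 / 4 by rw [hc₀]; norm_num] at h
    exact h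
  have hchain := (hLHS.trans hCarl).trans (mul_le_mul_of_nonneg_left hRHS hc₀0.le)
  -- linear arithmetic in the five integrals
  set Iw := ∫ z, W z * ‖w z‖ ^ 2 with hIw
  set Ig := ∫ z, W z * gradSq w z with hIg
  set J1 := ∫ z, W z * (gradSq η z * ‖v z‖ ^ 2) with hJ1
  set J2 := ∫ z, W z * ((dt η z + lap η z) ^ 2 * ‖v z‖ ^ 2) with hJ2
  set J3 := ∫ z, W z * (gradSq η z * gradSq v z) with hJ3
  have hIP0 : 0 ≤ Iw + 2 * Ig + 2 * J1 := by linarith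
  have h6 : c₀ * (6 * c ^ 2 * (Iw + 2 * Ig + 2 * J1)) ≤ (1 / 4) * (Iw + 2 * Ig + 2 * J1) := by
    have := mul_le_mul_of_nonneg_right hcc hIP0
    linarith [this]
  -- ### the left-hand side on `G`
  have hG : ∫ z in G, W z * ‖v z‖ ^ 2 ≤ Iw := by
    have e : ∫ z in G, W z * ‖v z‖ ^ 2 = ∫ z in G, W z * ‖w z‖ ^ 2 :=
      setIntegral_congr_fun hGm fun z hz => by simp [hw, hG1 z hz]
    rw [e]
    exact setIntegral_le_integral iw (Eventually.of_forall fun z => mul_nonneg (hW0 z) (sq_nonneg _))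
  rw [hc₀] at hchain h6
  linarith [hchain, h6, hI0w, hI0g, hJ10, hJ20, hJ30, hG]


end CoreSecondC12

end Carleman

end Literature.Analysis.FluidPDE
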